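import Mathlib.Analysis.Complex.PhragmenLindelof
import Mathlib.Analysis.Complex.LocallyUniformLimit
import Mathlib.Analysis.Complex.ReImTopology
import Mathlib.Analysis.SpecialFunctions.Gaussian.GaussianIntegral
import Mathlib.Analysis.Calculus.ParametricIntegral
import Mathlib.Analysis.CStarAlgebra.Spectrum
import Mathlib.MeasureTheory.Integral.Bochner.ContinuousLinearMap
import Mathlib.MeasureTheory.Group.Integral
import Literature.Analysis.FunctionSpaces.KMSStates
import Literature.MathematicalPhysics.QuantumLattice.QuasiLocalAlgebraProofs
import HarnessLib

/-!
# KMS states: the entire-element form of the KMS condition (proofs)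

This file proves the corrected form of the named fact `Literature.MathematicalPhysics.QuantumLattice.State.isKMSState_iff_entire` of
`Literature/Analysis/FunctionSpaces/KMSStates.lean` (with `[StarOrderedRing A]`, so that
states are continuous): for a strongly continuous one-parameter
group `τ` of ⋆-automorphisms of a unital C⋆-algebra `A`, an inverse temperature `β > 0` and a
state `ω` (continuous, via `[StarOrderedRing A]`), the strip form of the `(τ, β)`-KMS condition
(`State.IsKMSState`, Bratteli–Robinson II Prop. 5.3.7 (2)) is equivalent to the relation
`ω(a τ_{iβ}(b)) = ω(b a)` for all `a ∈ A` and all entire analytic elements `b`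
(Bratteli–Robinson II Def. 5.3.1; Sakai, *Operator algebras in dynamical systems*, Prop. 4.3.4).

Architecture of the printed proof (BR II Prop. 5.3.7, Sakai Prop. 4.3.4) and of this file:

* `Literature.MathematicalPhysics.QuantumLattice.IsAutomorphismGroup.map_add_apply'`, `Literature.Analysis.FunctionSpaces.autCLM`: group law (with the API of
  `QuasiLocalAlgebraProofs`), isometry (`StarAlgEquiv.norm_map`).
* `Literature.Analysis.FunctionSpaces.entire_eq_of_eqOn_real`: two entire functions agreeing on `ℝ` agree (identity theorem).
* `Literature.Analysis.FunctionSpaces.norm_le_of_kmsStrip` (Phragmén–Lindelöf on the strip `0 ≤ Im z ≤ β`) and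
  `Literature.Analysis.FunctionSpaces.eq_zero_of_kmsStrip`: a bounded function, continuous on the closed strip, analytic inside
  and vanishing on `ℝ` vanishes on the strip (via the weights `e^{iλz}`, `λ → ∞`).
* `Literature.IsEntireElementFor.*`: `F(s + z) = τ_s(F(z))`, hence `‖F z‖ = ‖F(i Im z)‖` is bounded on
  strips.
* (⇒) `Literature.MathematicalPhysics.QuantumLattice.State.IsKMSState.apply_mul_entire`: `F_{a,b} - ω(a F(·))` vanishes on `ℝ`, hence at
  `iβ`.
* Density of entire elements, Bratteli–Robinson I Prop. 2.5.22: the Gaussian regularisations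
  `b_r = ∫ e^{-t²} τ_{rt}(b) dt` are entire (`Literature.Analysis.FunctionSpaces.gaussMoll`, differentiation under the integral
  sign) and `b_r → √π b` as `r → 0` (dominated convergence):
  `Literature.MathematicalPhysics.QuantumLattice.IsAutomorphismGroup.exists_entire_tendsto`.
* (⇐) `Literature.MathematicalPhysics.QuantumLattice.State.IsKMSState.of_entire`: for entire `b` the strip function is `z ↦ ω(a F(z))`;
  for general `b` approximate by entire `b_n → b`; the strip functions are uniformly Cauchy by
  the three-lines bound and converge to a strip function for `(a, b)`.
* `Literature.MathematicalPhysics.QuantumLattice.State.isKMSState_iff_forall_entire` (the statement for states of the C⋆-algebra, explicit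
  form) and the discharge `Literature.MathematicalPhysics.QuantumLattice.State.isKMSState_iff_entire'_holds` of the corrected named fact
  `Literature.MathematicalPhysics.QuantumLattice.State.isKMSState_iff_entire'` (which carries `[StarOrderedRing A]`).
* `Literature.MathematicalPhysics.QuantumLattice.State.isKMSState_iff_entire_holds`: the un-primed named fact
  `Literature.MathematicalPhysics.QuantumLattice.State.isKMSState_iff_entire` is a `Prop` family indexed by the
  section implicits `{A} [CStarAlgebra A] [PartialOrder A] {τ} {β}` of `KMSStates.lean`; it is discharged here at
  every C⋆-ordered `A`, i.e. with `[StarOrderedRing A]` as a section instance (the source's generality: states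
  of the C⋆-algebra), while its bare universal closure over arbitrary partial orders is refuted in
  `KMSStatesEntireCounterexample.lean` (`Literature.MathematicalPhysics.QuantumLattice.State.not_isKMSState_iff_entire`).

Why a correction is needed. `Literature.MathematicalPhysics.QuantumLattice.State.isKMSState_iff_entire` sits in a section carrying only
`[PartialOrder A]`, i.e. an *arbitrary* partial order on `A`; for the discrete order every linear
functional `ω` with `ω 1 = 1` is a `State A`, and for discontinuous `ω` the equivalence is false,
so that fact cannot be discharged as stated. Counterexample: `A = M₂(ℓ^∞(ℕ))`, `h = diag(0, θ)`
with `θ = (θ_n)` a sequence of distinct reals in `(0, 1)`, `τ_t = Ad e^{ith}` (norm continuous;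
every `b` is entire with `τ_z(b) = e^{izh} b e^{-izh}`, so `τ_{iβ}(b) = e^{-βh} b e^{βh}`). The
entire-element relation `ω(a τ_{iβ}(b)) = ω(b a)` (all `a, b`) holds iff
`ω(x) = ψ(x₁₁) + ψ(λ x₂₂)` for some linear functional `ψ` on `ℓ^∞` with `ψ(1 + λ) = 1`, where
`λ = e^{-βθ} ∈ ℓ^∞`; the strip form, however, forces `t ↦ ω(τ_t(b) a) = ψ((1 + λ) e^{-iθt})`
(`a = E₂₁`, `b = (1 + λ) E₁₂`) to be continuous, and since the sequences `e^{-iθt}`,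
`t ∈ {0} ∪ {1/m : m ≥ 1}`, are linearly independent in `ℓ^∞` (a vanishing finite combination is a
polynomial in `e^{-iθ_n/N!}` with infinitely many roots), a Hamel-basis functional `ψ` with
`ψ((1 + λ) e^{-iθ/m}) = 0` for all `m` and `ψ(1 + λ) = 1` satisfies the entire-element relation but
is not a KMS state in the strip form. States of the C⋆-algebra (the C⋆-order, `[StarOrderedRing A]`)
are continuous (Bratteli–Robinson I Prop. 2.3.11), and for them the theorem holds as printed.

## Sources

* O. Bratteli, D. W. Robinson, *Operator Algebras and Quantum Statistical Mechanics I* (2nd ed.,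
  Springer 1987), Def. 2.5.20, Prop. 2.5.22.
* O. Bratteli, D. W. Robinson, *Operator Algebras and Quantum Statistical Mechanics II* (2nd
  ed., Springer 1997), Def. 5.3.1, Prop. 5.3.7.
* S. Sakai, *Operator algebras in dynamical systems* (CUP 1991), Def. 4.3.1, Prop. 4.3.4 (p. 132).
-/

noncomputable section

open Complex Topology Filter Set MeasureTheory

namespace Literature.Analysis.FunctionSpaces

section CStar

variable {A : Type*} [CStarAlgebra A]

/-! ### One-parameter automorphism groups: basic API -/

section IsAutomorphismGroup
open Literature.MathematicalPhysics.QuantumLattice (IsAutomorphismGroup)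
open Literature.MathematicalPhysics.QuantumLattice.IsAutomorphismGroup

variable {τ : ℝ → (A ≃⋆ₐ[ℂ] A)}

/-- Group law `τ_{s+t}(a) = τ_t(τ_s(a))` (the automorphisms `τ_s`, `τ_t` commute); companion of
`IsAutomorphismGroup.map_add_apply` (`QuasiLocalAlgebraProofs`). Bratteli–Robinson I Def. 2.7.1.
[folklore] -/
theorem _root_.Literature.MathematicalPhysics.QuantumLattice.IsAutomorphismGroup.map_add_apply' (hτ : IsAutomorphismGroup τ) (s t : ℝ) (a : A) :
    τ (s + t) a = τ t (τ s a) := by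
  rw [add_comm, hτ.map_add_apply]

end IsAutomorphismGroup

/-- ⋆-automorphisms of a C⋆-algebra are isometric (Mathlib `StarAlgEquiv.norm_map`).
Bratteli–Robinson I §2.3.1. [folklore] -/
theorem norm_aut_apply (τ : ℝ → (A ≃⋆ₐ[ℂ] A)) (t : ℝ) (a : A) : ‖τ t a‖ = ‖a‖ :=
  StarAlgEquiv.norm_map (τ t) a

/-- The automorphism `τ_t` as a continuous linear map (it is an isometry).
Bratteli–Robinson I §2.3.1, Def. 2.7.1. [folklore] -/
def autCLM (τ : ℝ → (A ≃⋆ₐ[ℂ] A)) (t : ℝ) : A →L[ℂ] A where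
  toFun := τ t
  map_add' := map_add (τ t)
  map_smul' := map_smul (τ t)
  cont := (StarAlgEquiv.isometry (τ t)).continuous

/-- `autCLM τ t` is `τ t` as a function. [folklore] -/
@[simp]
theorem autCLM_apply (τ : ℝ → (A ≃⋆ₐ[ℂ] A)) (t : ℝ) (a : A) : autCLM τ t a = τ t a := rfl

/-! ### Complex analysis on the strip -/

section Analysis

variable {E : Type*} [NormedAddCommGroup E] [NormedSpace ℂ E]

/-- Identity theorem: two entire functions which agree on the real axis agree everywhere.
[folklore] -/
theorem entire_eq_of_eqOn_real [CompleteSpace E] {f g : ℂ → E} (hf : Differentiable ℂ f)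
    (hg : Differentiable ℂ g) (h : ∀ t : ℝ, f t = g t) : f = g := by
  refine AnalyticOnNhd.eq_of_frequently_eq (z₀ := 0) (fun z _ => hf.analyticAt z)
    (fun z _ => hg.analyticAt z) ?_
  have ht : Tendsto (fun t : ℝ => (t : ℂ)) (𝓝[≠] 0) (𝓝[≠] 0) :=
    tendsto_nhdsWithin_of_tendsto_nhds_of_eventually_within _
      ((Complex.continuous_ofReal.tendsto' 0 0 Complex.ofReal_zero).mono_left nhdsWithin_le_nhds)
      (eventually_mem_nhdsWithin.mono fun t ht => by simpa using ht)
  exact ht.frequently (Frequently.of_forall h)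

variable {β : ℝ}

/-- The closure of the open strip `0 < Im z < β` is the KMS strip. [folklore] -/
theorem closure_im_preimage_Ioo (hβ : 0 < β) : closure (im ⁻¹' Ioo 0 β) = kmsStrip β := by
  rw [closure_preimage_im, closure_Ioo hβ.ne, kmsStrip]

/-- The KMS strip is the closure of the half-open strip `0 ≤ Im z < β`. [folklore] -/
theorem kmsStrip_eq_closure_Ico (hβ : 0 < β) : kmsStrip β = closure (im ⁻¹' Ico 0 β) := by
  rw [closure_preimage_im, closure_Ico hβ.ne, kmsStrip]

/-- **Phragmén–Lindelöf on the KMS strip**: a function which is analytic in the open strip,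
continuous and bounded on the closed strip and bounded by `C` on both boundary lines is bounded
by `C` on the strip. Bratteli–Robinson II Prop. 5.3.7 (proof). [folklore] -/
theorem norm_le_of_kmsStrip (hβ : 0 < β) {f : ℂ → E} (hd : DiffContOnCl ℂ f (im ⁻¹' Ioo 0 β))
    {K : ℝ} (hK : ∀ z ∈ kmsStrip β, ‖f z‖ ≤ K) {C : ℝ} (h0 : ∀ z : ℂ, z.im = 0 → ‖f z‖ ≤ C)
    (h1 : ∀ z : ℂ, z.im = β → ‖f z‖ ≤ C) {z : ℂ} (hz : z ∈ kmsStrip β) : ‖f z‖ ≤ C := by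
  refine PhragmenLindelof.horizontal_strip hd ⟨0, ?_, 0, ?_⟩ h0 h1 hz.1 hz.2
  · rw [sub_zero]; exact div_pos Real.pi_pos hβ
  · refine Asymptotics.IsBigO.of_bound (max K 0)
      (eventually_inf_principal.2 (Eventually.of_forall fun w hw => ?_))
    have : ‖f w‖ ≤ max K 0 := (hK w ⟨hw.1.le, hw.2.le⟩).trans (le_max_left K 0)
    simpa using this

/-- **Uniqueness on the strip**: a function which is analytic in the open strip `0 < Im z < β`,
continuous and bounded on the closed strip and which vanishes on the real axis vanishes on the
whole closed strip. (Apply Phragmén–Lindelöf to `e^{iλz} f(z)` and let `λ → ∞`; the top edge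
follows by continuity.) Sakai (1991) proof of Prop. 4.3.3 (via Schwarz reflection). [folklore] -/
theorem eq_zero_of_kmsStrip (hβ : 0 < β) {f : ℂ → E} (hd : DiffContOnCl ℂ f (im ⁻¹' Ioo 0 β))
    {K : ℝ} (hK : ∀ z ∈ kmsStrip β, ‖f z‖ ≤ K) (h0 : ∀ t : ℝ, f t = 0) {z : ℂ}
    (hz : z ∈ kmsStrip β) : f z = 0 := by
  -- Step 1: below the top edge.
  have key : EqOn f 0 (im ⁻¹' Ico 0 β) := by
    intro w hw
    have hnorm : ∀ (L : ℝ) (z : ℂ), ‖cexp (I * L * z)‖ = Real.exp (-(L * z.im)) := by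
      intro L z
      rw [norm_exp]
      congr 1
      simp [mul_re]
    have hL : ∀ L : ℝ, 0 < L → ‖f w‖ ≤ Real.exp (-(L * (β - w.im))) * K := by
      intro L hL
      have hgd : DiffContOnCl ℂ (fun z => cexp (I * L * z) • f z) (im ⁻¹' Ioo 0 β) :=
        (Differentiable.diffContOnCl (by fun_prop)).smul hd
      have hgK : ∀ z ∈ kmsStrip β, ‖cexp (I * L * z) • f z‖ ≤ K := by
        intro z hz
        rw [norm_smul, hnorm]
        calc Real.exp (-(L * z.im)) * ‖f z‖ ≤ 1 * K :=
              mul_le_mul (Real.exp_le_one_iff.2 (by nlinarith [hz.1])) (hK z hz) (norm_nonneg _)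
                zero_le_one
          _ = K := one_mul K
      have hb0 : ∀ z : ℂ, z.im = 0 → ‖cexp (I * L * z) • f z‖ ≤ Real.exp (-(L * β)) * K := by
        intro z hz0
        have hz' : z = (z.re : ℂ) := Complex.ext (by simp) (by simp [hz0])
        have hK0 : 0 ≤ K := (norm_nonneg _).trans (hK w ⟨hw.1, hw.2.le⟩)
        rw [hz', h0, smul_zero, norm_zero]
        positivity
      have hb1 : ∀ z : ℂ, z.im = β → ‖cexp (I * L * z) • f z‖ ≤ Real.exp (-(L * β)) * K := by
        intro z hz1
        rw [norm_smul, hnorm, hz1]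
        exact mul_le_mul_of_nonneg_left (hK z (by simp [kmsStrip, hz1, hβ.le])) (Real.exp_pos _).le
      have := norm_le_of_kmsStrip hβ hgd hgK hb0 hb1 (z := w) ⟨hw.1, hw.2.le⟩
      rw [norm_smul, hnorm, ← le_div_iff₀' (Real.exp_pos _)] at this
      refine this.trans (le_of_eq ?_)
      rw [mul_div_right_comm, ← Real.exp_sub]
      ring_nf
    have hc : 0 < β - w.im := sub_pos.2 hw.2
    have ht : Tendsto (fun L : ℝ => Real.exp (-(L * (β - w.im))) * K) atTop (𝓝 (0 * K)) :=
      (Real.tendsto_exp_atBot.comp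
        (tendsto_neg_atTop_atBot.comp (tendsto_id.atTop_mul_const hc))).mul_const K
    rw [zero_mul] at ht
    have : ‖f w‖ ≤ 0 :=
      ge_of_tendsto ht (Filter.eventually_atTop.2 ⟨1, fun L hL1 => hL L (by linarith)⟩)
    exact norm_le_zero_iff.1 this
  -- Step 2: the top edge, by continuity.
  have hcont : ContinuousOn f (kmsStrip β) := by
    rw [← closure_im_preimage_Ioo hβ]; exact hd.continuousOn
  have heq : EqOn f 0 (kmsStrip β) := by
    refine key.of_subset_closure hcont continuousOn_const (fun w hw => ⟨hw.1, hw.2.le⟩) ?_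
    rw [kmsStrip_eq_closure_Ico hβ]
  exact heq hz

end Analysis

/-! ### Entire analytic elements -/

namespace IsEntireElementFor

variable {τ : ℝ → (A ≃⋆ₐ[ℂ] A)} {b : A} {F : ℂ → A}

/-- Scalar multiples of entire elements are entire. Bratteli–Robinson I Prop. 2.5.22
("the analytic elements form a subspace"). [folklore] -/
theorem smul (h : IsEntireElementFor τ b F) (c : ℂ) : IsEntireElementFor τ (c • b) (c • F) :=
  ⟨h.1.const_smul c, fun t => by simp [h.2 t, map_smul]⟩

/-- Translates of entire elements are entire, with the translated extension.
cf. Bratteli–Robinson I Cor. 2.5.24 (proof). [folklore] -/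
theorem translate (hτ : Literature.MathematicalPhysics.QuantumLattice.IsAutomorphismGroup τ) (h : IsEntireElementFor τ b F) (s : ℝ) :
    IsEntireElementFor τ (τ s b) fun z => F (s + z) :=
  ⟨h.1.comp ((differentiable_id (𝕜 := ℂ)).const_add _), fun t => by
    have := h.2 (s + t)
    push_cast at this
    show F (s + t) = _
    rw [this, hτ.map_add_apply']⟩

/-- The entire extension intertwines real translations with the dynamics:
`F(s + z) = τ_s(F(z))` (both sides are entire in `z` and agree on `ℝ`).
Bratteli–Robinson I Def. 2.5.20. [folklore] -/
theorem apply_real_add (hτ : Literature.MathematicalPhysics.QuantumLattice.IsAutomorphismGroup τ) (h : IsEntireElementFor τ b F) (s : ℝ)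
    (z : ℂ) : F (s + z) = τ s (F z) := by
  have h1 : Differentiable ℂ fun z : ℂ => F (s + z) :=
    h.1.comp ((differentiable_id (𝕜 := ℂ)).const_add _)
  have h2 : Differentiable ℂ fun z : ℂ => τ s (F z) := (autCLM τ s).differentiable.comp h.1
  have := entire_eq_of_eqOn_real h1 h2 fun t => by
    show F (s + t) = τ s (F t)
    rw [h.2 t, ← ofReal_add, h.2, hτ.map_add_apply]
  exact congrFun this z

/-- `‖F(z)‖ = ‖F(i Im z)‖` for the entire extension of the orbit of an entire element
(automorphisms are isometric). Bratteli–Robinson II Prop. 5.3.7 (proof). [folklore] -/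
theorem norm_apply (hτ : Literature.MathematicalPhysics.QuantumLattice.IsAutomorphismGroup τ) (h : IsEntireElementFor τ b F) (z : ℂ) :
    ‖F z‖ = ‖F (z.im * I)‖ := by
  conv_lhs => rw [← re_add_im z]
  rw [h.apply_real_add hτ, norm_aut_apply]

/-- The entire extension of the orbit of an entire element is bounded on every KMS strip.
Bratteli–Robinson II Prop. 5.3.7 (proof). [folklore] -/
theorem exists_norm_le (hτ : Literature.MathematicalPhysics.QuantumLattice.IsAutomorphismGroup τ) (h : IsEntireElementFor τ b F) (β : ℝ) :
    ∃ C, ∀ z ∈ kmsStrip β, ‖F z‖ ≤ C := by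
  have hc : Continuous fun s : ℝ => F (s * I) := by
    have := h.1.continuous
    fun_prop
  obtain ⟨C, hC⟩ := (isCompact_Icc (a := (0 : ℝ)) (b := β)).exists_bound_of_continuousOn
    hc.continuousOn
  refine ⟨C, fun z hz => ?_⟩
  rw [h.norm_apply hτ]
  exact hC z.im ⟨hz.1, hz.2⟩

end IsEntireElementFor

/-! ### Gaussian regularisation -/

section Gauss

variable {E : Type*} [NormedAddCommGroup E] [NormedSpace ℂ E]

/-- Modulus of the Gaussian kernel `e^{-(t - z)²}`. [folklore] -/
theorem norm_cexp_neg_sq (z : ℂ) (t : ℝ) :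
    ‖cexp (-((t : ℂ) - z) ^ 2)‖ = Real.exp (z.im ^ 2) * Real.exp (-(t - z.re) ^ 2) := by
  rw [norm_exp, ← Real.exp_add]
  congr 1
  simp [sq, sub_re, sub_im, mul_re]
  ring

/-- The Gaussian regularisation integrand `e^{-(t-z)²} v(t)` is integrable for `v` continuous and
bounded. Bratteli–Robinson I Prop. 2.5.18 / 2.5.22 (proof). [folklore] -/
theorem integrable_gaussConv (v : ℝ → E) (hv : Continuous v) (M : ℝ) (hM : ∀ t, ‖v t‖ ≤ M)
    (z : ℂ) : Integrable fun t : ℝ => cexp (-((t : ℂ) - z) ^ 2) • v t := by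
  have hi : Integrable
      (fun t : ℝ => Real.exp (z.im ^ 2) * M * Real.exp (-1 * (t - z.re) ^ 2)) :=
    ((integrable_exp_neg_mul_sq one_pos).comp_sub_right z.re).const_mul _
  refine hi.mono'
    (by fun_prop : Continuous fun t : ℝ => cexp (-((t : ℂ) - z) ^ 2) • v t).aestronglyMeasurable
    (Eventually.of_forall fun t => ?_)
  rw [norm_smul, norm_cexp_neg_sq]
  calc Real.exp (z.im ^ 2) * Real.exp (-(t - z.re) ^ 2) * ‖v t‖
      ≤ Real.exp (z.im ^ 2) * Real.exp (-(t - z.re) ^ 2) * M := by gcongr; exact hM t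
    _ = _ := by ring_nf

/-- **Gaussian regularisation is entire**: for `v : ℝ → E` continuous and bounded,
`z ↦ ∫ e^{-(t - z)²} v(t) dt` is an entire function (differentiation under the integral sign).
Bratteli–Robinson I Prop. 2.5.22 (proof). [folklore] -/
theorem differentiable_gaussConv [CompleteSpace E] (v : ℝ → E) (hv : Continuous v) (M : ℝ)
    (hM : ∀ t, ‖v t‖ ≤ M) :
    Differentiable ℂ fun z : ℂ => ∫ t : ℝ, cexp (-((t : ℂ) - z) ^ 2) • v t := by
  intro z₀
  have hM0 : 0 ≤ M := (norm_nonneg _).trans (hM 0)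
  set F' : ℂ → ℝ → E := fun z t => (cexp (-((t : ℂ) - z) ^ 2) * (2 * ((t : ℂ) - z))) • v t
    with hF'
  set bound : ℝ → ℝ := fun t =>
    2 * (Real.exp ((|z₀.im| + 1) ^ 2) * Real.exp 1) *
      ((|t - z₀.re| + (|z₀.im| + 2)) * Real.exp (-(1 / 2) * (t - z₀.re) ^ 2)) * M with hbound
  have key := hasDerivAt_integral_of_dominated_loc_of_deriv_le (μ := volume)
    (F := fun z t => cexp (-((t : ℂ) - z) ^ 2) • v t) (F' := F') (x₀ := z₀) (bound := bound)
    (s := Metric.ball z₀ 1) (Metric.ball_mem_nhds z₀ one_pos) ?_ (integrable_gaussConv v hv M hM z₀)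
    ?_ ?_ ?_ ?_
  · exact key.2.differentiableAt
  · exact Eventually.of_forall fun z =>
      (by fun_prop : Continuous fun t : ℝ => cexp (-((t : ℂ) - z) ^ 2) • v t).aestronglyMeasurable
  · exact (by rw [hF']; fun_prop : Continuous (F' z₀)).aestronglyMeasurable
  · -- the uniform bound on the derivative over the ball
    refine Eventually.of_forall fun t z hz => ?_
    rw [Metric.mem_ball, dist_eq_norm] at hz
    have hre : |z.re - z₀.re| < 1 := by simpa using (abs_re_le_norm (z - z₀)).trans_lt hz
    have him : |z.im - z₀.im| < 1 := by simpa using (abs_im_le_norm (z - z₀)).trans_lt hz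
    have h1 : ‖(t : ℂ) - z‖ ≤ |t - z₀.re| + (|z₀.im| + 2) := by
      refine (norm_le_abs_re_add_abs_im _).trans ?_
      simp only [sub_re, ofReal_re, sub_im, ofReal_im, zero_sub, abs_neg]
      have e1 : |t - z.re| ≤ |t - z₀.re| + 1 := by
        calc |t - z.re| = |(t - z₀.re) - (z.re - z₀.re)| := by ring_nf
          _ ≤ |t - z₀.re| + |z.re - z₀.re| := abs_sub _ _
          _ ≤ |t - z₀.re| + 1 := by linarith
      have e2 : |z.im| ≤ |z₀.im| + 1 := by
        linarith [abs_sub_abs_le_abs_sub z.im z₀.im]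
      linarith
    have h2 : Real.exp (z.im ^ 2) ≤ Real.exp ((|z₀.im| + 1) ^ 2) := by
      have e2 : |z.im| ≤ |z₀.im| + 1 := by
        linarith [abs_sub_abs_le_abs_sub z.im z₀.im]
      exact Real.exp_le_exp.2 (by nlinarith [sq_abs z.im, abs_nonneg z.im])
    have h3 : Real.exp (-(t - z.re) ^ 2) ≤
        Real.exp 1 * Real.exp (-(1 / 2) * (t - z₀.re) ^ 2) := by
      rw [← Real.exp_add]
      gcongr
      obtain ⟨hq1, hq2⟩ := abs_lt.1 hre
      nlinarith [sq_nonneg (t - z.re - (z.re - z₀.re))]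
    rw [hF']
    dsimp only
    rw [norm_smul, norm_mul, norm_cexp_neg_sq, norm_mul, RCLike.norm_ofNat]
    calc Real.exp (z.im ^ 2) * Real.exp (-(t - z.re) ^ 2) * (2 * ‖(t : ℂ) - z‖) * ‖v t‖
        ≤ Real.exp ((|z₀.im| + 1) ^ 2) * (Real.exp 1 * Real.exp (-(1 / 2) * (t - z₀.re) ^ 2)) *
          (2 * (|t - z₀.re| + (|z₀.im| + 2))) * M := by
          gcongr
          exact hM t
      _ = bound t := by rw [hbound]; ring
  · -- integrability of the bound
    have hI1 : Integrable fun u : ℝ => |u| * Real.exp (-(1 / 2) * u ^ 2) := by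
      have := (integrable_mul_exp_neg_mul_sq (b := 1 / 2) (by norm_num)).norm
      refine this.congr (Eventually.of_forall fun u => ?_)
      simp [abs_of_pos (Real.exp_pos _)]
    have hI2 : Integrable fun u : ℝ => Real.exp (-(1 / 2) * u ^ 2) :=
      integrable_exp_neg_mul_sq (by norm_num)
    have hI : Integrable fun u : ℝ => (|u| + (|z₀.im| + 2)) * Real.exp (-(1 / 2) * u ^ 2) := by
      have := hI1.add (hI2.const_mul (|z₀.im| + 2))
      refine this.congr (Eventually.of_forall fun u => ?_)
      simp only [Pi.add_apply]
      ring
    have := ((hI.comp_sub_right z₀.re).const_mul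
      (2 * (Real.exp ((|z₀.im| + 1) ^ 2) * Real.exp 1))).mul_const M
    exact this
  · refine Eventually.of_forall fun t z _ => ?_
    have : HasDerivAt (fun x : ℂ => cexp (-((t : ℂ) - x) ^ 2))
        (cexp (-((t : ℂ) - z) ^ 2) * (2 * ((t : ℂ) - z))) z := by
      refine ((((hasDerivAt_id z).const_sub (t : ℂ)).fun_pow 2).fun_neg.cexp).congr_deriv ?_
      simp only [id_eq]
      push_cast
      ring
    exact this.smul_const (v t)

end Gauss

/-! ### Density of entire analytic elements (Bratteli–Robinson I Prop. 2.5.22) -/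

section Density

variable {τ : ℝ → (A ≃⋆ₐ[ℂ] A)}

/-- The **Gaussian regularisation** of the orbit of `b` under a rescaled dynamics:
`gaussMoll τ r b z = ∫ e^{-(t - z)²} τ_{rt}(b) dt`. For `z = 0` this is `√π` times the
element `A_n` of Bratteli–Robinson I Prop. 2.5.22 (with `r = 1/√n`); as a function of `z` it is
the entire extension of `s ↦ τ_s(gaussMoll τ r b 0)` evaluated at `z = s / r`.
[cite: BratteliRobinsonI1987, Prop. 2.5.22] -/
def gaussMoll (τ : ℝ → (A ≃⋆ₐ[ℂ] A)) (r : ℝ) (b : A) (z : ℂ) : A :=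
  ∫ t : ℝ, cexp (-((t : ℂ) - z) ^ 2) • τ (r * t) b

/-- The Gaussian regularisation is entire in `z`. Bratteli–Robinson I Prop. 2.5.22.
[cite: BratteliRobinsonI1987, Prop. 2.5.22] -/
theorem differentiable_gaussMoll (hτ : Literature.MathematicalPhysics.QuantumLattice.IsAutomorphismGroup τ) (r : ℝ) (b : A) :
    Differentiable ℂ (gaussMoll τ r b) :=
  differentiable_gaussConv _ ((hτ.continuous_apply b).comp (continuous_const.mul continuous_id)) ‖b‖
    fun t => (norm_aut_apply τ (r * t) b).le

/-- **The Gaussian regularisations are entire analytic elements**: `w ↦ gaussMoll τ r b (w / r)`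
is the entire extension of `s ↦ τ_s (gaussMoll τ r b 0)` (translation invariance of Lebesgue
measure and `τ_s ∫ = ∫ τ_s`). Bratteli–Robinson I Prop. 2.5.22.
[cite: BratteliRobinsonI1987, Prop. 2.5.22] -/
theorem isEntireElementFor_gaussMoll (hτ : Literature.MathematicalPhysics.QuantumLattice.IsAutomorphismGroup τ) {r : ℝ} (hr : r ≠ 0) (b : A) :
    IsEntireElementFor τ (gaussMoll τ r b 0) fun w => gaussMoll τ r b (w / r) := by
  refine ⟨(differentiable_gaussMoll hτ r b).comp (differentiable_id.div_const _), fun s => ?_⟩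
  have hint : Integrable fun t : ℝ => cexp (-((t : ℂ) - 0) ^ 2) • τ (r * t) b :=
    integrable_gaussConv _ ((hτ.continuous_apply b).comp (continuous_const.mul continuous_id)) ‖b‖
      (fun t => (norm_aut_apply τ _ b).le) 0
  have h1 : gaussMoll τ r b ((s : ℂ) / r) = ∫ u : ℝ, cexp (-(u : ℂ) ^ 2) • τ (r * u + s) b := by
    unfold gaussMoll
    rw [← integral_add_right_eq_self _ (s / r)]
    congr 1
    ext u
    congr 2
    · push_cast
      field_simp
      ring
    · congr 1
      field_simp
  have h2 : τ s (gaussMoll τ r b 0) = ∫ u : ℝ, cexp (-(u : ℂ) ^ 2) • τ (r * u + s) b := by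
    unfold gaussMoll
    rw [← autCLM_apply τ s, ← ContinuousLinearMap.integral_comp_comm _ hint]
    congr 1
    ext u
    rw [sub_zero, ContinuousLinearMap.map_smul, autCLM_apply, hτ.map_add_apply']
  show gaussMoll τ r b ((s : ℂ) / r) = τ s (gaussMoll τ r b 0)
  rw [h1, h2]

/-- The Gaussian integral `∫ e^{-t²} dt = √π`, complex form. [folklore] -/
theorem integral_cexp_neg_sq : ∫ t : ℝ, cexp (-((t : ℂ) - 0) ^ 2) = (Real.sqrt Real.pi : ℂ) := by
  rw [show (fun t : ℝ => cexp (-((t : ℂ) - 0) ^ 2)) = fun t : ℝ => ((Real.exp (-1 * t ^ 2) : ℝ) : ℂ)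
    by ext t; push_cast; ring_nf]
  rw [integral_complex_ofReal, integral_gaussian, div_one]

/-- **Convergence of the Gaussian regularisations**: `gaussMoll τ (1/(n+1)) b 0 → √π • b`
(dominated convergence and strong continuity of `τ` at `0`). Bratteli–Robinson I Prop. 2.5.22.
[cite: BratteliRobinsonI1987, Prop. 2.5.22] -/
theorem tendsto_gaussMoll (hτ : Literature.MathematicalPhysics.QuantumLattice.IsAutomorphismGroup τ) (b : A) :
    Tendsto (fun n : ℕ => gaussMoll τ (1 / ((n : ℝ) + 1)) b 0) atTop
      (𝓝 ((Real.sqrt Real.pi : ℂ) • b)) := by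
  have hlim : (Real.sqrt Real.pi : ℂ) • b = ∫ t : ℝ, cexp (-((t : ℂ) - 0) ^ 2) • b := by
    rw [integral_smul_const, integral_cexp_neg_sq]
  rw [hlim]
  unfold gaussMoll
  refine tendsto_integral_filter_of_dominated_convergence
    (fun t => Real.exp ((0 : ℂ).im ^ 2) * Real.exp (-(t - (0 : ℂ).re) ^ 2) * ‖b‖) ?_ ?_ ?_ ?_
  · refine Eventually.of_forall fun n => Continuous.aestronglyMeasurable ?_
    exact (by fun_prop : Continuous fun t : ℝ => cexp (-((t : ℂ) - 0) ^ 2)).smul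
      ((hτ.continuous_apply b).comp (continuous_const.mul continuous_id))
  · refine Eventually.of_forall fun n => Eventually.of_forall fun t => ?_
    rw [norm_smul, norm_cexp_neg_sq, norm_aut_apply]
  · have := ((integrable_exp_neg_mul_sq one_pos).comp_sub_right (0 : ℂ).re).const_mul
      (Real.exp ((0 : ℂ).im ^ 2)) |>.mul_const ‖b‖
    refine this.congr (Eventually.of_forall fun t => ?_)
    simp
  · refine Eventually.of_forall fun t => Tendsto.smul tendsto_const_nhds ?_
    have h0 := (hτ.continuous_apply b).tendsto 0
    rw [hτ.map_zero_apply] at h0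
    refine h0.comp ?_
    simpa using
      (tendsto_one_div_add_atTop_nhds_zero_nat (𝕜 := ℝ)).mul (tendsto_const_nhds (x := t))

/-- **Density of entire analytic elements** (sequential form): every `b ∈ A` is the norm limit
of a sequence of entire analytic elements for `τ` (namely `π^{-1/2}` times the Gaussian
regularisations). Bratteli–Robinson I Prop. 2.5.22 and Cor. 2.5.23.
[cite: BratteliRobinsonI1987, Prop. 2.5.22] -/
theorem _root_.Literature.MathematicalPhysics.QuantumLattice.IsAutomorphismGroup.exists_entire_tendsto (hτ : Literature.MathematicalPhysics.QuantumLattice.IsAutomorphismGroup τ) (b : A) :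
    ∃ (bs : ℕ → A) (Fs : ℕ → ℂ → A),
      (∀ n, IsEntireElementFor τ (bs n) (Fs n)) ∧ Tendsto bs atTop (𝓝 b) := by
  have hπ : (Real.sqrt Real.pi : ℂ) ≠ 0 := by
    exact_mod_cast (Real.sqrt_pos.2 Real.pi_pos).ne'
  refine ⟨fun n => (Real.sqrt Real.pi : ℂ)⁻¹ • gaussMoll τ (1 / ((n : ℝ) + 1)) b 0,
    fun n => (Real.sqrt Real.pi : ℂ)⁻¹ • fun w => gaussMoll τ (1 / ((n : ℝ) + 1)) b
      (w / (1 / ((n : ℝ) + 1) : ℝ)), fun n => ?_, ?_⟩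
  · exact (isEntireElementFor_gaussMoll hτ (r := 1 / ((n : ℝ) + 1)) (by positivity) b).smul _
  · have := (tendsto_gaussMoll hτ b).const_smul (Real.sqrt Real.pi : ℂ)⁻¹
    rwa [smul_smul, inv_mul_cancel₀ hπ, one_smul] at this

end Density

/-! ### The KMS condition and entire elements -/

section States

variable [PartialOrder A] [StarOrderedRing A] {τ : ℝ → (A ≃⋆ₐ[ℂ] A)} {β : ℝ}

/-- Operator-norm bound for a state (as a continuous linear functional).
Bratteli–Robinson I Prop. 2.3.11. [folklore] -/
theorem _root_.Literature.MathematicalPhysics.QuantumLattice.State.norm_apply_le_opNorm_mul (ω : Literature.MathematicalPhysics.QuantumLattice.State A) (x : A) :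
    ‖ω x‖ ≤ ‖ω.toContinuousLinearMap‖ * ‖x‖ :=
  ω.toContinuousLinearMap.le_opNorm x

/-- `z ↦ ω(a F(z))` is entire for an entire extension `F`. Sakai (1991) Prop. 4.3.4 (proof).
[folklore] -/
theorem _root_.Literature.MathematicalPhysics.QuantumLattice.State.differentiable_apply_mul (ω : Literature.MathematicalPhysics.QuantumLattice.State A) (a : A) {F : ℂ → A}
    (hF : Differentiable ℂ F) : Differentiable ℂ fun z => ω (a * F z) :=
  ω.toContinuousLinearMap.differentiable.comp (hF.const_mul a)

/-- For an entire element `b` (with entire extension `F`) and a state satisfying the algebraic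
KMS relation on entire elements, `z ↦ ω(a F(z))` is a KMS strip function for the pair `(a, b)`.
Sakai (1991) Prop. 4.3.4 (proof, first half of the converse); Bratteli–Robinson II
Prop. 5.3.7. [folklore] -/
theorem _root_.Literature.MathematicalPhysics.QuantumLattice.State.kmsStripFun_of_entire (hτ : Literature.MathematicalPhysics.QuantumLattice.IsAutomorphismGroup τ) {ω : Literature.MathematicalPhysics.QuantumLattice.State A}
    (h : ∀ (a b : A) (F : ℂ → A), IsEntireElementFor τ b F → ω (a * F (β * I)) = ω (b * a))
    (a b : A) (F : ℂ → A) (hF : IsEntireElementFor τ b F) :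
    ContinuousOn (fun z => ω (a * F z)) (kmsStrip β) ∧
      DifferentiableOn ℂ (fun z => ω (a * F z)) {z | 0 < z.im ∧ z.im < β} ∧
      (∃ C, ∀ z ∈ kmsStrip β, ‖ω (a * F z)‖ ≤ C) ∧
      (∀ t : ℝ, ω (a * F t) = ω (a * τ t b)) ∧ ∀ t : ℝ, ω (a * F (t + β * I)) = ω (τ t b * a) := by
  have hd := ω.differentiable_apply_mul a hF.1
  obtain ⟨C, hC⟩ := hF.exists_norm_le hτ β
  refine ⟨hd.continuous.continuousOn, hd.differentiableOn,
    ⟨‖ω.toContinuousLinearMap‖ * (‖a‖ * C), fun z hz => ?_⟩, fun t => by rw [hF.2 t], fun t => ?_⟩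
  · refine (ω.norm_apply_le_opNorm_mul _).trans (mul_le_mul_of_nonneg_left ?_ (norm_nonneg _))
    exact (norm_mul_le _ _).trans (mul_le_mul_of_nonneg_left (hC z hz) (norm_nonneg _))
  · exact h a (τ t b) _ (hF.translate hτ t)

/-- **KMS states satisfy the KMS relation on entire elements** (strip form ⇒ entire-element
form): if `ω` is a `(τ, β)`-KMS state, `β > 0`, and `b` is an entire analytic element with
entire extension `F` of `t ↦ τ_t(b)`, then `ω(a F(iβ)) = ω(b a)`. (The strip function `F_{a,b}`
and the entire function `z ↦ ω(a F(z))` agree on `ℝ`, hence on the strip.)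
Bratteli–Robinson II Prop. 5.3.7; Sakai (1991) Prop. 4.3.4.
[cite: BratteliRobinsonII1997, Prop. 5.3.7] -/
theorem _root_.Literature.MathematicalPhysics.QuantumLattice.State.IsKMSState.apply_mul_entire (hτ : Literature.MathematicalPhysics.QuantumLattice.IsAutomorphismGroup τ) (hβ : 0 < β)
    {ω : Literature.MathematicalPhysics.QuantumLattice.State A} (hω : ω.IsKMSState τ β) (a b : A) (F : ℂ → A)
    (hF : IsEntireElementFor τ b F) : ω (a * F (β * I)) = ω (b * a) := by
  obtain ⟨G, hGc, hGd, ⟨C, hGC⟩, hG0, hG1⟩ := hω a b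
  obtain ⟨C', hC'⟩ := hF.exists_norm_le hτ β
  have hHd : DiffContOnCl ℂ (fun z => G z - ω (a * F z)) (im ⁻¹' Ioo 0 β) := by
    refine DiffContOnCl.sub ⟨hGd, ?_⟩ (ω.differentiable_apply_mul a hF.1).diffContOnCl
    rw [closure_im_preimage_Ioo hβ]
    exact hGc
  have hHK : ∀ z ∈ kmsStrip β,
      ‖G z - ω (a * F z)‖ ≤ C + ‖ω.toContinuousLinearMap‖ * (‖a‖ * C') := by
    intro z hz
    refine (norm_sub_le _ _).trans (add_le_add (hGC z hz) ?_)
    refine (ω.norm_apply_le_opNorm_mul _).trans (mul_le_mul_of_nonneg_left ?_ (norm_nonneg _))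
    exact (norm_mul_le _ _).trans (mul_le_mul_of_nonneg_left (hC' z hz) (norm_nonneg _))
  have hH0 : ∀ t : ℝ, G t - ω (a * F t) = 0 := fun t => by rw [hG0 t, hF.2 t, sub_self]
  have := eq_zero_of_kmsStrip hβ hHd hHK hH0 (z := β * I) (by simp [kmsStrip, hβ.le])
  have h1 := hG1 0
  simp only [ofReal_zero, zero_add, hτ.map_zero_apply] at h1
  rw [sub_eq_zero, h1] at this
  exact this.symm

/-- **The KMS relation on entire elements implies the strip form of the KMS condition**
(entire-element form ⇒ strip form): for entire `b` the strip function is `z ↦ ω(a F(z))`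
(`State.kmsStripFun_of_entire`); a general `b` is the norm limit of entire elements `b_n`
(`IsAutomorphismGroup.exists_entire_tendsto`), the corresponding strip functions are uniformly
Cauchy on the closed strip by the Phragmén–Lindelöf bound `norm_le_of_kmsStrip`, and their
uniform limit is a strip function for `(a, b)`. Bratteli–Robinson II Prop. 5.3.7;
Sakai (1991) Prop. 4.3.4. [cite: BratteliRobinsonII1997, Prop. 5.3.7] -/
theorem _root_.Literature.MathematicalPhysics.QuantumLattice.State.IsKMSState.of_entire (hτ : Literature.MathematicalPhysics.QuantumLattice.IsAutomorphismGroup τ) (hβ : 0 < β) {ω : Literature.MathematicalPhysics.QuantumLattice.State A}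
    (h : ∀ (a b : A) (F : ℂ → A), IsEntireElementFor τ b F → ω (a * F (β * I)) = ω (b * a)) :
    ω.IsKMSState τ β := by
  intro a b
  obtain ⟨bs, Fs, hFs, hbs⟩ := hτ.exists_entire_tendsto b
  set G : ℕ → ℂ → ℂ := fun n z => ω (a * Fs n z) with hG
  have hGs := fun n => Literature.MathematicalPhysics.QuantumLattice.State.kmsStripFun_of_entire hτ h a (bs n) (Fs n) (hFs n)
  set L : ℝ := ‖ω.toContinuousLinearMap‖ * ‖a‖ with hL
  have hL0 : 0 ≤ L := by positivity
  -- Step 1: the difference of two strip functions is controlled by `‖bs m - bs n‖`.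
  have hdiff : ∀ m n, ∀ z ∈ kmsStrip β, ‖G m z - G n z‖ ≤ L * ‖bs m - bs n‖ := by
    intro m n z hz
    have hd : DiffContOnCl ℂ (fun z => G m z - G n z) (im ⁻¹' Ioo 0 β) := by
      refine DiffContOnCl.sub ⟨(hGs m).2.1, ?_⟩ ⟨(hGs n).2.1, ?_⟩ <;>
        rw [closure_im_preimage_Ioo hβ]
      exacts [(hGs m).1, (hGs n).1]
    obtain ⟨Cm, hCm⟩ := (hGs m).2.2.1
    obtain ⟨Cn, hCn⟩ := (hGs n).2.2.1
    refine norm_le_of_kmsStrip hβ hd (K := Cm + Cn)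
      (fun w hw => (norm_sub_le _ _).trans (add_le_add (hCm w hw) (hCn w hw)))
      (fun w hw0 => ?_) (fun w hw1 => ?_) hz
    · have hw : w = (w.re : ℂ) := Complex.ext (by simp) (by simp [hw0])
      rw [hw]
      show ‖ω (a * Fs m (w.re : ℂ)) - ω (a * Fs n (w.re : ℂ))‖ ≤ _
      rw [(hGs m).2.2.2.1, (hGs n).2.2.2.1, ← map_sub, ← mul_sub, ← map_sub]
      refine (ω.norm_apply_le_opNorm_mul _).trans ?_
      rw [hL, mul_assoc]
      gcongr
      exact (norm_mul_le _ _).trans (by rw [norm_aut_apply])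
    · have hw : w = (w.re : ℂ) + β * I := Complex.ext (by simp) (by simp [hw1])
      rw [hw]
      show ‖ω (a * Fs m ((w.re : ℂ) + β * I)) - ω (a * Fs n ((w.re : ℂ) + β * I))‖ ≤ _
      rw [(hGs m).2.2.2.2, (hGs n).2.2.2.2, ← map_sub, ← sub_mul, ← map_sub]
      refine (ω.norm_apply_le_opNorm_mul _).trans ?_
      rw [hL, mul_assoc]
      gcongr
      exact (norm_mul_le _ _).trans (by rw [norm_aut_apply, mul_comm])
  -- Step 2: the strip functions are uniformly Cauchy, hence converge uniformly.
  have hC : UniformCauchySeqOn G atTop (kmsStrip β) := by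
    rw [Metric.uniformCauchySeqOn_iff]
    intro ε hε
    obtain ⟨N, hN⟩ := Metric.cauchySeq_iff.1 hbs.cauchySeq (ε / (L + 1)) (by positivity)
    refine ⟨N, fun m hm n hn z hz => ?_⟩
    rw [dist_eq_norm]
    calc ‖G m z - G n z‖ ≤ L * ‖bs m - bs n‖ := hdiff m n z hz
      _ ≤ (L + 1) * ‖bs m - bs n‖ := by gcongr; linarith
      _ < (L + 1) * (ε / (L + 1)) := by
          gcongr
          rw [← dist_eq_norm]
          exact hN m hm n hn
      _ = ε := by field_simp
  have hpt : ∀ z ∈ kmsStrip β,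
      Tendsto (fun n => G n z) atTop (𝓝 (limUnder atTop fun n => G n z)) :=
    fun z hz => tendsto_nhds_limUnder (cauchySeq_tendsto_of_complete (hC.cauchySeq hz))
  have hU : TendstoUniformlyOn G (fun z => limUnder atTop fun n => G n z) atTop (kmsStrip β) :=
    hC.tendstoUniformlyOn_of_tendsto hpt
  -- Step 3: the uniform limit is a strip function for `(a, b)`.
  have hcont : ∀ t : ℝ, Continuous fun x : A => ω (a * τ t x) := fun t =>
    ω.toContinuousLinearMap.continuous.comp (continuous_const.mul (autCLM τ t).continuous)
  have hcont' : ∀ t : ℝ, Continuous fun x : A => ω (τ t x * a) := fun t =>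
    ω.toContinuousLinearMap.continuous.comp ((autCLM τ t).continuous.mul continuous_const)
  refine ⟨fun z => limUnder atTop fun n => G n z, ?_, ?_, ?_, fun t => ?_, fun t => ?_⟩
  · exact hU.continuousOn (Frequently.of_forall fun n => (hGs n).1)
  · have hU' : TendstoLocallyUniformlyOn G (fun z => limUnder atTop fun n => G n z) atTop
        (im ⁻¹' Ioo 0 β) :=
      (hU.mono fun z hz => ⟨hz.1.le, hz.2.le⟩).tendstoLocallyUniformlyOn
    exact hU'.differentiableOn (Eventually.of_forall fun n => (hGs n).2.1)
      (isOpen_Ioo.preimage continuous_im)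
  · obtain ⟨N, hN⟩ := ((Metric.tendstoUniformlyOn_iff.1 hU) 1 one_pos).exists
    obtain ⟨C, hC⟩ := (hGs N).2.2.1
    refine ⟨C + 1, fun z hz => ?_⟩
    have h1 := hN z hz
    rw [dist_eq_norm] at h1
    exact (norm_le_insert' _ _).trans (add_le_add (hC z hz) h1.le)
  · have h1 := hpt t (ofReal_mem_kmsStrip hβ.le t)
    have h2 : Tendsto (fun n => G n t) atTop (𝓝 (ω (a * τ t b))) := by
      have : (fun n => G n t) = fun n => ω (a * τ t (bs n)) := funext fun n => (hGs n).2.2.2.1 t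
      rw [this]
      exact ((hcont t).tendsto b).comp hbs
    exact tendsto_nhds_unique h1 h2
  · have h1 := hpt ((t : ℂ) + β * I) (ofReal_add_mul_I_mem_kmsStrip hβ.le t)
    have h2 : Tendsto (fun n => G n ((t : ℂ) + β * I)) atTop (𝓝 (ω (τ t b * a))) := by
      have : (fun n => G n ((t : ℂ) + β * I)) = fun n => ω (τ t (bs n) * a) :=
        funext fun n => (hGs n).2.2.2.2 t
      rw [this]
      exact ((hcont' t).tendsto b).comp hbs
    exact tendsto_nhds_unique h1 h2

/-- **The KMS condition on entire elements** (Bratteli–Robinson II Def. 5.3.1 ⇔ Prop. 5.3.7):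
for a strongly continuous automorphism group `τ` of a C⋆-algebra, `β > 0` and a state `ω`
(continuous, the order being the C⋆-order), `ω` is a `(τ, β)`-KMS state (strip form) iff
`ω(a F(iβ)) = ω(b a)` for every `a` and every entire analytic element `b` with entire
extension `F` of `t ↦ τ_t(b)`. Bratteli–Robinson II Prop. 5.3.7; Sakai (1991) Prop. 4.3.4.
[cite: BratteliRobinsonII1997, Prop. 5.3.7] -/
theorem _root_.Literature.MathematicalPhysics.QuantumLattice.State.isKMSState_iff_forall_entire (hτ : Literature.MathematicalPhysics.QuantumLattice.IsAutomorphismGroup τ) (hβ : 0 < β)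
    (ω : Literature.MathematicalPhysics.QuantumLattice.State A) :
    ω.IsKMSState τ β ↔
      ∀ (a b : A) (F : ℂ → A), IsEntireElementFor τ b F → ω (a * F (β * I)) = ω (b * a) :=
  ⟨fun hω a b F hF => hω.apply_mul_entire hτ hβ a b F hF,
    fun h => Literature.MathematicalPhysics.QuantumLattice.State.IsKMSState.of_entire hτ hβ h⟩

/-- **Discharge of the corrected named fact `State.isKMSState_iff_entire'`** (Bratteli–Robinson II
Def. 5.3.1 ⇔ Prop. 5.3.7, states of the C⋆-algebra `A` with its C⋆-order `[StarOrderedRing A]`),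
by `State.isKMSState_iff_forall_entire`. (The un-primed `State.isKMSState_iff_entire`, stated for
an arbitrary `[PartialOrder A]`, is false in that generality — see the module docstring; it is
discharged only at C⋆-ordered `A`, with `[StarOrderedRing A]` as a section instance, as
`State.isKMSState_iff_entire_holds` below.) [cite: BratteliRobinsonII1997, Prop. 5.3.7] -/
theorem _root_.Literature.MathematicalPhysics.QuantumLattice.State.isKMSState_iff_entire'_holds :
    Literature.MathematicalPhysics.QuantumLattice.State.isKMSState_iff_entire' (A := A) (τ := τ) (β := β) :=
  fun hτ hβ ω => Literature.MathematicalPhysics.QuantumLattice.State.isKMSState_iff_forall_entire hτ hβ ω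

/-- **Discharge of the named fact `State.isKMSState_iff_entire` at every C⋆-ordered `A`**
(Bratteli–Robinson II Def. 5.3.1 ⇔ Prop. 5.3.7; Sakai, *Operator algebras in dynamical systems*
(1991), Def. 4.3.1 (p. 130) and Prop. 4.3.4 (p. 132): "a state `φ` on `A` is a KMS state for
`{A, α}` at `β` iff `φ(a α_{iβ}(b)) = φ(b a)`" for all `a` and all analytic `b`): for a strongly
continuous automorphism group `τ`, `β > 0` and every state `ω` of the C⋆-algebra `A`, the strip
form `State.IsKMSState ω τ β` holds iff `ω(a F(iβ)) = ω(b a)` for every `a` and every entire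
analytic element `b` with entire extension `F` of `t ↦ τ_t(b)`.

**Scope of this discharge — read before consuming.** The named fact
`State.isKMSState_iff_entire` (`KMSStates.lean`) is a `def … : Prop` whose only parameters are the
*section implicits* `{A} [CStarAlgebra A] [PartialOrder A] {τ} {β}`, i.e. it is a `Prop` family
indexed in particular by an *arbitrary* partial order on `A` (for which `State A`, a monotone
normalised linear functional, need not be continuous). Its bare universal closure
`∀ A [CStarAlgebra A] [PartialOrder A] τ β, State.isKMSState_iff_entire` is **false**: the sorry-free
refutation is `Literature.MathematicalPhysics.QuantumLattice.State.not_isKMSState_iff_entire`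
(`KMSStatesEntireCounterexample.lean`: `A = M₂(C([0,1], ℂ))` with the discrete order,
`τ_t = Ad diag(1, e^{itx})`, a Hamel-basis functional). The source's statement concerns states of
the C⋆-algebra (positive for the C⋆-order, hence continuous, Bratteli–Robinson I Prop. 2.3.11), and
both directions of the printed proof use that continuity. Accordingly this theorem sits in a
section carrying `[StarOrderedRing A]` (the order of `A` *is* the C⋆-order) as a section instance,
exactly like the discharge `State.isKMSState_iff_entire'_holds` of the closed corrected fact
`State.isKMSState_iff_entire'` (whose body is verbatim that of the un-primed fact): it proves the
family at every C⋆-ordered `A`, all `τ`, all `β` — the full generality of the source — and nothing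
is claimed for other orders. A consumer holding `(h : State.isKMSState_iff_entire)` in a context with
`[StarOrderedRing A]` may replace `h` by this theorem; without that instance no discharge exists
(and none can). Same pattern as `Literature.Analysis.FunctionSpaces.memHomBesov_iff_memBesovSup_holds`
(`[Nontrivial E]` as a section instance, corrected closed fact under a new name).
[cite: BratteliRobinsonII1997, Prop. 5.3.7] [cite: Sakai1991, Prop. 4.3.4] -/
theorem _root_.Literature.MathematicalPhysics.QuantumLattice.State.isKMSState_iff_entire_holds :
    Literature.MathematicalPhysics.QuantumLattice.State.isKMSState_iff_entire (A := A) (τ := τ) (β := β) :=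
  fun hτ hβ ω => Literature.MathematicalPhysics.QuantumLattice.State.isKMSState_iff_forall_entire hτ hβ ω

/-- Under the C⋆-order (`[StarOrderedRing A]`) the un-primed named fact
`State.isKMSState_iff_entire` and the corrected closed fact `State.isKMSState_iff_entire'` are the
same proposition (their bodies coincide verbatim; the correction consists precisely of the instance
binder). Bratteli–Robinson II Prop. 5.3.7. [folklore] -/
theorem _root_.Literature.MathematicalPhysics.QuantumLattice.State.isKMSState_iff_entire_iff_isKMSState_iff_entire' :
    Literature.MathematicalPhysics.QuantumLattice.State.isKMSState_iff_entire (A := A) (τ := τ) (β := β) ↔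
      Literature.MathematicalPhysics.QuantumLattice.State.isKMSState_iff_entire' (A := A) (τ := τ) (β := β) :=
  Iff.rfl

end States

end CStar

end Literature.Analysis.FunctionSpaces
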